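import Summits.KontsevichZagierPeriods.KontsevichZagierPeriods.Theorems.RootDecompWalshStrataVertexChart01

/-!
# Conic descent, gen 6 (L5/L6 general fibrewise vertex chart, band move, edge pull-back for ellipse-type fibres), part 2/3

Declarations `vchart_mem_relations` … `gW_gV_mul_deriv` of the farm-checked gen-6 monolith; see the module docstring of
`VertexChart01` (part 1) for the overview, the design and the sources. [KontsevichZagier2001 §1.2 rules (2),(3); BCR1998 §2.2; this node gen 5 `sqrtDescent₂_ball`]
-/

noncomputable section

open Literature.NumberTheory.Transcendental
open MeasureTheory Set
open MvPolynomial (aeval X C)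
open Literature.ModelTheory.ExponentialFields (IsSemialgebraic isSemialgebraic_univ
  isSemialgebraic_setOf_eval_pos isSemialgebraic_setOf_eval_lt isSemialgebraic_setOf_eval_le
  isSemialgebraic_setOf_eval_nonneg isSemialgebraic_setOf_eval_eq_zero continuous_aeval_real
  tarski_seidenberg_real_holds)

namespace Summit.KontsevichZagierPeriods.RootDecompWalshStrata.ConicDescent.VertexChart

variable {m : ℚ}
variable {Y₀ H : Polynomial ℚ}

/-- **Move (2), the general fibrewise vertex chart (ellipse type).**  For representations `ρ`
(chart plane, domain `S ⊆ {m v² < 1, H(x) > 0}`, weight `γ·H(x)·g_m(v)`) and `σ` (the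
`(x, y)`-plane, domain `Φ(S)`, weight `γ·√(H(x) − m(y − Y₀(x))²)`):  `[ρ] − [σ] ∈ relations` —
one application of KZ's rule (2) with the `ℚ`-semialgebraic injective chart `Φ`
(`√D ∘ Φ·|det Φ'| = √H·T_m · √H·U_m′ = H·g_m`).  No `√m`, no `√H` survives in the chart plane.
[KontsevichZagier2001 §1.2 rule (2)] -/
theorem vchart_mem_relations (hm : 0 < m) (γ : ℚ) (ρ σ : KZ.IntegralRep 2)
    (hdom : ∀ p ∈ ρ.domain, (m : ℝ) * p 0 ^ 2 < 1 ∧ 0 < Polynomial.aeval (p 1) H)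
    (hρ : ∀ p ∈ ρ.domain, ρ.integrand p = (γ : ℝ) * Polynomial.aeval (p 1) H * gW m (p 0))
    (hσd : σ.domain = vΦ m Y₀ H '' ρ.domain)
    (hσ : ∀ u ∈ σ.domain, σ.integrand u =
      (γ : ℝ) * √(Polynomial.aeval (u 0) H - m * (u 1 - Polynomial.aeval (u 0) Y₀) ^ 2)) :
    KZ.of ρ - KZ.of σ ∈ KZ.relations := by
  have hm0 : 0 ≤ m := hm.le
  refine KZ.changeOfVariablesRel_subset_relations
    ⟨2, ρ, σ, vΦ m Y₀ H, vΦ' m Y₀ H, isSemialgebraicMapOn_vΦ hm0 ρ.isSemialgebraic_domain,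
      fun p hp => (hasFDerivAt_vΦ hm0 p (hdom p hp).2).hasFDerivWithinAt,
      (injOn_vΦ hm0).mono fun p hp => hdom p hp, hσd, fun p hp => ?_, rfl⟩
  have hv := (hdom p hp).1
  have hH := (hdom p hp).2
  have hdet : (vΦ' m Y₀ H p).det ≤ 0 := by
    rw [vΦ'_det]
    exact neg_nonpos.2 (mul_nonneg (vS_nonneg _ _) (gU'_nonneg hm0 hv.le))
  rw [hρ p hp, hσ _ (hσd ▸ mem_image_of_mem _ hp), abs_of_nonpos hdet, vΦ'_det, neg_neg, vΦ_zero,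
    sqrt_D_vΦ hm0 p hH.le hv.le, gW_eq hm0]
  have hS2 : vS H (p 1) * vS H (p 1) = Polynomial.aeval (p 1) H := by
    rw [← sq]; exact vS_sq hH.le
  linear_combination (-((γ : ℝ) * gT m (p 0) * gU' m (p 0))) * hS2

/-! #### 25.4 The dictionary to `Quadric₃`: ellipse-type coefficients -/

open BallCube in
/-- For a quadric `K` in normal form, `D(x, y) = d₂·y² + d₁(x)·y + d₀(x)` with
`d₂ = b₂² − 4A·c₂₂`, `d₁(x) = 2b₂(b₀ + b₁x) − 4A(c₂ + c₁₂x)`,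
`d₀(x) = (b₀ + b₁x)² − 4A(c₀ + c₁x + c₁₁x²)`. -/
theorem Dxy_eq (K : Quadric₃) (x y : ℝ) :
    K.Dxy x y = ((K.b2 ^ 2 - 4 * K.A * K.c22 : ℚ) : ℝ) * y ^ 2 +
      ((2 * K.b2 * K.b0 - 4 * K.A * K.c2 : ℚ) + (2 * K.b2 * K.b1 - 4 * K.A * K.c12 : ℚ) * x) * y +
      (((K.b0 : ℝ) + K.b1 * x) ^ 2 - 4 * K.A * (K.c0 + K.c1 * x + K.c11 * x ^ 2)) := by
  simp only [Quadric₃.Dxy, Quadric₃.Bxy, Quadric₃.Cxy]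
  push_cast
  ring

open BallCube in
/-- ELLIPSE TYPE: if `d₂ = −m < 0` then `D(x, y) = H(x) − m(y − Y₀(x))²` with the explicit
`Y₀ = d₁/(2m)`, `H = d₀ + d₁²/(4m)` ∈ ℚ[X]` — the vertex form to which `vchart_mem_relations`
applies. -/
theorem Dxy_eq_vertex (K : Quadric₃) (m : ℚ) (hm : m ≠ 0) (hd₂ : K.b2 ^ 2 - 4 * K.A * K.c22 = -m)
    (x y : ℝ) :
    K.Dxy x y =
      Polynomial.aeval x
          (Polynomial.C ((K.b0 ^ 2 - 4 * K.A * K.c0) + (2 * K.b2 * K.b0 - 4 * K.A * K.c2) ^ 2 / (4 * m)) +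
            Polynomial.C ((2 * K.b0 * K.b1 - 4 * K.A * K.c1) +
              2 * (2 * K.b2 * K.b0 - 4 * K.A * K.c2) * (2 * K.b2 * K.b1 - 4 * K.A * K.c12) / (4 * m)) *
              Polynomial.X +
            Polynomial.C ((K.b1 ^ 2 - 4 * K.A * K.c11) + (2 * K.b2 * K.b1 - 4 * K.A * K.c12) ^ 2 / (4 * m)) *
              Polynomial.X ^ 2) -
        m * (y - Polynomial.aeval x
          (Polynomial.C ((2 * K.b2 * K.b0 - 4 * K.A * K.c2) / (2 * m)) +
            Polynomial.C ((2 * K.b2 * K.b1 - 4 * K.A * K.c12) / (2 * m)) * Polynomial.X)) ^ 2 := by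
  have hm' : (m : ℝ) ≠ 0 := by exact_mod_cast hm
  have hd : ((K.b2 : ℝ) ^ 2 - 4 * K.A * K.c22) = -m := by exact_mod_cast hd₂
  simp only [Quadric₃.Dxy, Quadric₃.Bxy, Quadric₃.Cxy, map_add, map_mul, map_pow, Polynomial.aeval_C,
    Polynomial.aeval_X, eq_ratCast]
  push_cast
  field_simp
  linear_combination (16 * (m : ℝ) * y ^ 2) * hd

/-! #### 25.5 Rule (3) in `x` for the chart weight: `∂/∂x [γ·Hi(x)·g_m(v)] = γ·H(x)·g_m(v)` -/

/-- `Fin.snoc u t : Fin 2 → ℝ` evaluated at the last index `1` is `t` (pointwise `rfl`; part-local, `private`). -/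
@[simp] private theorem snoc₁_apply_one (u : Fin 1 → ℝ) (t : ℝ) : (Fin.snoc u t : Fin 2 → ℝ) 1 = t := rfl

/-- `Fin.snoc u t : Fin 2 → ℝ` evaluated at `0` is `u 0` (pointwise `rfl`; part-local, `private`). -/
@[simp] private theorem snoc₁_apply_zero (u : Fin 1 → ℝ) (t : ℝ) : (Fin.snoc u t : Fin 2 → ℝ) 0 = u 0 := rfl

/-- The primitive in `x`: `F(x, v) = γ·Hi(x)·g_m(v)` (`Hi′ = H`). -/
def vF (m : ℚ) (Hi : Polynomial ℚ) (γ : ℚ) (x v : ℝ) : ℝ := (γ : ℝ) * Polynomial.aeval x Hi * gW m v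

/-- `|F(x, v)| ≤ 2|γ|·Mi` where `|Hi(x)| ≤ Mi`. -/
theorem abs_vF_le (hm : 0 ≤ m) (Hi : Polynomial ℚ) (γ : ℚ) {Mi x : ℝ}
    (hx : |Polynomial.aeval x Hi| ≤ Mi) (v : ℝ) : |vF m Hi γ x v| ≤ |(γ : ℝ)| * Mi * 2 := by
  rw [vF, abs_mul, abs_mul, abs_of_nonneg (gW_nonneg hm _)]
  have hM0 : 0 ≤ Mi := (abs_nonneg _).trans hx
  exact mul_le_mul (mul_le_mul_of_nonneg_left hx (abs_nonneg _)) (gW_le_two hm v)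
    (gW_nonneg hm _) (by positivity)

/-- `∂F/∂x = γ·H(x)·g_m(v)` when `Hi′ = H`. [calculus] -/
theorem hasDerivAt_vF {Hi : Polynomial ℚ} (hHi : Polynomial.derivative Hi = H) (γ : ℚ) (x v : ℝ) :
    HasDerivAt (fun t => vF m Hi γ t v) ((γ : ℝ) * Polynomial.aeval x H * gW m v) x := by
  have h := ((Hi.hasDerivAt_aeval x).const_mul (γ : ℝ)).mul_const (gW m v)
  rw [hHi] at h
  exact h

/-- `F` is continuous in `x`. -/
theorem continuous_vF (Hi : Polynomial ℚ) (γ : ℚ) (v : ℝ) : Continuous fun t => vF m Hi γ t v := by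
  unfold vF
  exact (continuous_const.mul (Polynomial.continuous_aeval (p := Hi))).mul continuous_const

/-- `w ↦ P(u(w))` is semialgebraic for a semialgebraic `u` and `P ∈ ℚ[X]`. [BCR1998 §2.2] -/
theorem isSemialgebraicFunOn_aeval_comp {N : ℕ} {B : Set (Fin N → ℝ)} (hB : IsSemialgebraic ℚ B)
    {u : (Fin N → ℝ) → ℝ} (hu : IsSemialgebraicFunOn ℚ B u) (P : Polynomial ℚ) :
    IsSemialgebraicFunOn ℚ B fun w => Polynomial.aeval (u w) P := by
  induction P using Polynomial.induction_on' with
  | add p q hp hq =>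
    exact (hp.add_holds hq).congr fun w _ => by simp only [Pi.add_apply, map_add]
  | monomial n a =>
    induction n with
    | zero =>
      exact (isSemialgebraicFunOn_ratCast hB a).congr fun w _ => by
        simp
    | succ n ih =>
      exact (ih.mul_holds hu).congr fun w _ => by
        simp only [Pi.mul_apply, Polynomial.aeval_monomial, pow_succ]
        ring

/-- `w ↦ F(u(w), w 0)` is semialgebraic for a semialgebraic `u`. -/
theorem isSemialgebraicFunOn_vF (hm : 0 ≤ m) {B : Set (Fin 1 → ℝ)} (hB : IsSemialgebraic ℚ B)
    {u : (Fin 1 → ℝ) → ℝ} (hu : IsSemialgebraicFunOn ℚ B u) (Hi : Polynomial ℚ) (γ : ℚ) :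
    IsSemialgebraicFunOn ℚ B fun w => vF m Hi γ (u w) (w 0) := by
  have hg : IsSemialgebraicFunOn ℚ B fun w => gW m (w 0) :=
    (isSemialgebraicFunOn_aeval_div_aeval hB (C 2 * (1 - C m * X 0 ^ 2) ^ 2) ((1 + C m * X 0 ^ 2) ^ 3)
      fun w _ => by
        have h : (0:ℝ) < (1 + (m : ℝ) * w 0 ^ 2) ^ 3 := pow_pos (one_add_pos hm (w 0)) 3
        simpa using h.ne').congr fun w _ => by
      simp only [map_mul, map_sub, map_pow, map_add, map_one, MvPolynomial.aeval_C,
        MvPolynomial.aeval_X, eq_ratCast, gW]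
      push_cast
      ring
  exact (((isSemialgebraicFunOn_ratCast hB γ).mul_holds (isSemialgebraicFunOn_aeval_comp hB hu Hi)).mul_holds
    hg).congr fun w _ => by simp only [vF, Pi.mul_apply]

/-- **Rule (3) in `x`** for the chart weight over a base `B` (a bounded semialgebraic piece of the
`v`-line) with semialgebraic edges `0 ≤ l ≤ u ≤ 1`:
`[oband B l u, γ·H(x)·g_m(v)] ≡ [B, F(u(v), v) − F(l(v), v)]`, `F = γ·Hi(x)·g_m(v)`, `Hi′ = H`
(Newton–Leibniz on the closed band, whose edges are null).  `M, Mi` bound `|H|, |Hi|` on `[0, 1]`.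
[KontsevichZagier2001 §1.2 rules (1), (3)] -/
theorem vband_move (hm : 0 ≤ m) {B : Set (Fin 1 → ℝ)} (hBs : IsSemialgebraic ℚ B)
    {a b : Fin 1 → ℝ} (hB : B ⊆ Icc a b)
    {l u : (Fin 1 → ℝ) → ℝ} (hl : IsSemialgebraicFunOn ℚ B l) (hu : IsSemialgebraicFunOn ℚ B u)
    (hl0 : ∀ w ∈ B, 0 ≤ l w) (hlu : ∀ w ∈ B, l w ≤ u w) (hu1 : ∀ w ∈ B, u w ≤ 1) (γ : ℚ)
    {Hi : Polynomial ℚ} (hHi : Polynomial.derivative Hi = H)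
    (M : ℝ) (hM : ∀ x : ℝ, 0 ≤ x → x ≤ 1 → |Polynomial.aeval x H| ≤ M)
    (Mi : ℝ) (hMi : ∀ x : ℝ, 0 ≤ x → x ≤ 1 → |Polynomial.aeval x Hi| ≤ Mi)
    (ρ : KZ.IntegralRep 2) (hρd : ρ.domain = oband B l u)
    (hρi : ∀ z ∈ ρ.domain, ρ.integrand z = (γ : ℝ) * Polynomial.aeval (z 1) H * gW m (z 0))
    (τ : KZ.IntegralRep 1) (hτd : τ.domain = B)
    (hτi : ∀ w ∈ B, τ.integrand w = vF m Hi γ (u w) (w 0) - vF m Hi γ (l w) (w 0)) :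
    KZ.of ρ - KZ.of τ ∈ KZ.relations := by
  have hband : IsSemialgebraic ℚ (KZlog.band B l u) := KZlog.isSemialgebraic_band hl hu
  have hbandI : KZlog.band B l u ⊆ Icc (Fin.snoc a 0) (Fin.snoc b 1) := by
    intro z hz
    rw [KZlog.mem_band] at hz
    obtain ⟨hzX, h1, h2⟩ := hz
    have hI := hB hzX
    refine ⟨fun j => ?_, fun j => ?_⟩
    · refine Fin.lastCases ?_ (fun i => ?_) j
      · simpa using (hl0 _ hzX).trans h1
      · simpa [Fin.init] using hI.1 i
    · refine Fin.lastCases ?_ (fun i => ?_) j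
      · simpa using h2.trans (hu1 _ hzX)
      · simpa [Fin.init] using hI.2 i
  have hx01 : ∀ z ∈ KZlog.band B l u, 0 ≤ z 1 ∧ z 1 ≤ 1 := by
    intro z hz
    rw [KZlog.mem_band] at hz
    obtain ⟨hzX, h1, h2⟩ := hz
    exact ⟨(hl0 _ hzX).trans h1, h2.trans (hu1 _ hzX)⟩
  have hbandb : Bornology.IsBounded (KZlog.band B l u) :=
    (isCompact_Icc (a := (Fin.snoc a 0 : Fin 2 → ℝ)) (b := Fin.snoc b 1)).isBounded.subset hbandI
  have hBb : Bornology.IsBounded B := (isCompact_Icc (a := a) (b := b)).isBounded.subset hB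
  have hF : IsSemialgebraicFunOn ℚ (KZlog.band B l u) fun z => vF m Hi γ (z 1) (z 0) :=
    (isSemialgebraicFunOn_weight hm hband γ).congr fun z _ => rfl
  have hf : IsSemialgebraicFunOn ℚ (KZlog.band B l u)
      fun z => (γ : ℝ) * Polynomial.aeval (z 1) H * gW m (z 0) :=
    isSemialgebraicFunOn_weight hm hband γ
  have hds : IsSemialgebraicFunOn ℚ B fun w => vF m Hi γ (u w) (w 0) - vF m Hi γ (l w) (w 0) :=
    IsSemialgebraicFunOn.sub_holds (isSemialgebraicFunOn_vF hm hBs hu Hi γ)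
      (isSemialgebraicFunOn_vF hm hBs hl Hi γ)
  have hbd : ∀ w ∈ B, |vF m Hi γ (u w) (w 0) - vF m Hi γ (l w) (w 0)| ≤
      |(γ : ℝ)| * Mi * 2 + |(γ : ℝ)| * Mi * 2 := by
    intro w hw
    have hl0' := hl0 w hw; have hlu' := hlu w hw; have hu1' := hu1 w hw
    exact (abs_sub _ _).trans (add_le_add
      (abs_vF_le hm Hi γ (hMi _ (hl0'.trans hlu') hu1') _)
      (abs_vF_le hm Hi γ (hMi _ hl0' (hlu'.trans hu1')) _))
  obtain ⟨rb, rd, hrbd, hrbi, hrdd, hrdi, hrel⟩ := KZ.exists_band_newtonLeibniz hBs l u hl hu hlu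
    (fun z => vF m Hi γ (z 1) (z 0)) (fun z => (γ : ℝ) * Polynomial.aeval (z 1) H * gW m (z 0)) hF hf
    (fun w _ => by
      simp only [snoc₁_apply_one, snoc₁_apply_zero]
      exact (continuous_vF Hi γ (w 0)).continuousOn)
    (fun w _ t _ => by
      simp only [snoc₁_apply_one, snoc₁_apply_zero]
      exact hasDerivAt_vF hHi γ t (w 0))
    (integrableOn_of_bdd hband hbandb hf (|(γ : ℝ)| * M * 2) fun z hz => by
      have h01 := hx01 z hz
      rw [abs_mul, abs_mul, abs_of_nonneg (gW_nonneg hm _)]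
      have hM0 : 0 ≤ M := (abs_nonneg _).trans (hM _ h01.1 h01.2)
      exact mul_le_mul (mul_le_mul_of_nonneg_left (hM _ h01.1 h01.2) (abs_nonneg _)) (gW_le_two hm _)
        (gW_nonneg hm _) (by positivity))
    (hds.congr fun w _ => by simp only [snoc₁_apply_one, snoc₁_apply_zero])
    ((integrableOn_of_bdd hBs hBb hds _ hbd).congr_fun
      (fun w _ => by simp only [snoc₁_apply_one, snoc₁_apply_zero]) hBs.measurableSet_holds)
  obtain ⟨r', hr'd, hr'i, hrel'⟩ := KZ.of_sub_of_restrict_openBand_mem_relations hl hu rb hrbd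
  have h1 : KZ.of ρ - KZ.of r' ∈ KZ.relations :=
    KZ.of_sub_of_mem_relations_of_eqOn (by rw [hr'd, hρd]; rfl) fun z hz => by
      rw [hr'i, hrbi, hρi z hz]
  have h2 : KZ.of rd - KZ.of τ ∈ KZ.relations :=
    KZ.of_sub_of_mem_relations_of_eqOn (by rw [hrdd, hτd]) fun w hw => by
      rw [hrdd] at hw
      rw [hrdi, hτi w hw]
      simp only [snoc₁_apply_one, snoc₁_apply_zero]
  have : KZ.of ρ - KZ.of τ =
      (KZ.of ρ - KZ.of r') - (KZ.of rb - KZ.of r') + (KZ.of rb - KZ.of rd) + (KZ.of rd - KZ.of τ) := by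
    abel
  rw [this]
  exact KZ.relations.add_mem (KZ.relations.add_mem (KZ.relations.sub_mem h1 hrel') hrel) h2

/-! #### 25.6 The edge identity: boundary terms reparametrised by `x` are `m`-free

After `vband_move` a boundary piece reads `[I, ±F(u(v), v)] = [I, ±γ·Hi(u(v))·g_m(v)]` along an
edge `x = u(v)` of a chart-plane cell.  When that edge is the chart preimage of a boundary curve
`y = y_b(x)` of the original atom (so `U_m(v_b(x)) = r(x) := (y_b(x) − Y₀(x))/√H(x)`), the 1-dim
change of variables `v = v_b(x)` turns the weight into
`γ·Hi(x)·g_m(v_b(x))·v_b′(x) = γ·Hi(x)·T_m(v_b(x))·r′(x)`, and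
`√H(x)·T_m(v_b(x)) = √D(x, y_b(x)) =: t_b(x)` — so the integrand is
`γ·Hi(x)·t_b(x)·(2H(x)(y_b′ − Y₀′) − (y_b − Y₀)H′(x)) / (2H(x)²)`: NO `m`, and exactly one radical
(`t_b = |B|` on `C = 0`, `|2A + B|` on `A + B + C = 0`, `0` on `D = 0`, `√D(x, c)` on `y = c`) —
the input shape of `InBaker.sqrt_rational` / `InBaker.sqrt_rational_div` (gen 6). -/

/-- Chain rule along an edge: if `U_m ∘ v_b = r` near `x` then `g_m(v_b(x))·v_b′ = T_m(v_b(x))·r′`. -/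
theorem edge_weight (hm : 0 ≤ m) {vb r : ℝ → ℝ} {vb' r' x : ℝ} (hvb : HasDerivAt vb vb' x)
    (hr : HasDerivAt r r' x) (hUr : ∀ᶠ s in nhds x, gU m (vb s) = r s) :
    gW m (vb x) * vb' = gT m (vb x) * r' := by
  have h1 : HasDerivAt (fun s => gU m (vb s)) (gU' m (vb x) * vb') x :=
    (hasDerivAt_gU hm (vb x)).comp x hvb
  have h2 : HasDerivAt r (gU' m (vb x) * vb') x :=
    h1.congr_of_eventuallyEq (hUr.mono fun s hs => hs.symm)
  rw [hr.unique h2, gW_eq hm]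
  ring

/-- `√H(x)·T_m(v) = √(H(x) − m(√H(x)·U_m(v))²)` (`= √D` at the image point) for `m v² ≤ 1`. -/
theorem vS_mul_gT (hm : 0 ≤ m) {x v : ℝ} (hx : 0 ≤ Polynomial.aeval x H) (hv : (m : ℝ) * v ^ 2 ≤ 1) :
    vS H x * gT m v = √(Polynomial.aeval x H - m * (vS H x * gU m v) ^ 2) := by
  have h := sqrt_D_vΦ (Y₀ := 0) hm ![v, x] hx hv
  simp only [vΦ_one, map_zero, zero_add, sub_zero, Matrix.cons_val_one, Matrix.cons_val_zero,
    Matrix.cons_val_fin_one] at h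
  exact h.symm

/-- The derivative of the edge ratio `r(x) = (y_b(x) − Y₀(x))/√H(x)`. [calculus] -/
theorem hasDerivAt_ratio {yb : ℝ → ℝ} {yb' x : ℝ} (hyb : HasDerivAt yb yb' x)
    (hx : 0 < Polynomial.aeval x H) :
    HasDerivAt (fun s => (yb s - Polynomial.aeval s Y₀) / vS H s)
      (((yb' - Polynomial.aeval x (Polynomial.derivative Y₀)) * vS H x -
        (yb x - Polynomial.aeval x Y₀) * (Polynomial.aeval x (Polynomial.derivative H) / (2 * vS H x))) /
        vS H x ^ 2) x :=
  (hyb.sub (Y₀.hasDerivAt_aeval x)).div (hasDerivAt_vS hx) (vS_pos hx).ne'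

/-- **The `m`-free edge integrand.**  With `t_b = √H(x)·T_m(v_b(x))` (`= √D(x, y_b(x))`):
`γ·Hi(x)·g_m(v_b(x))·v_b′(x) = γ·Hi(x)·t_b·(2H(y_b′ − Y₀′) − (y_b − Y₀)H′)/(2H²)`. -/
theorem edge_term_eq (hm : 0 ≤ m) {yb vb : ℝ → ℝ} {yb' vb' x : ℝ} (hyb : HasDerivAt yb yb' x)
    (hvb : HasDerivAt vb vb' x) (hx : 0 < Polynomial.aeval x H)
    (hUr : ∀ᶠ s in nhds x, gU m (vb s) = (yb s - Polynomial.aeval s Y₀) / vS H s)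
    (Hi : Polynomial ℚ) (γ : ℚ) :
    vF m Hi γ x (vb x) * vb' =
      (γ : ℝ) * Polynomial.aeval x Hi * (vS H x * gT m (vb x)) *
        ((2 * Polynomial.aeval x H * (yb' - Polynomial.aeval x (Polynomial.derivative Y₀)) -
            (yb x - Polynomial.aeval x Y₀) * Polynomial.aeval x (Polynomial.derivative H)) /
          (2 * Polynomial.aeval x H ^ 2)) := by
  have hS := vS_pos hx
  have hS2 : vS H x ^ 2 = Polynomial.aeval x H := vS_sq hx.le
  have hw := edge_weight hm hvb (hasDerivAt_ratio (Y₀ := Y₀) hyb hx) hUr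
  have hH : Polynomial.aeval x H ≠ 0 := hx.ne'
  calc vF m Hi γ x (vb x) * vb'
      = (γ : ℝ) * Polynomial.aeval x Hi * (gW m (vb x) * vb') := by rw [vF]; ring
    _ = (γ : ℝ) * Polynomial.aeval x Hi * (gT m (vb x) *
          (((yb' - Polynomial.aeval x (Polynomial.derivative Y₀)) * vS H x -
            (yb x - Polynomial.aeval x Y₀) *
              (Polynomial.aeval x (Polynomial.derivative H) / (2 * vS H x))) / vS H x ^ 2)) := by
        rw [hw]
    _ = _ := by
        rw [hS2]
        field_simp
        rw [← hS2]
        ring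

/-! #### 25.7 The inverse chart `V_m = U_m⁻¹` and the edge pull-back (rule (2) in one variable) -/

/-- `V_m(ρ) = ρ/(1 + √(1 − m ρ²))`, the inverse of `U_m` on `m ρ² ≤ 1` (rationalised form of
`(1 − √(1 − mρ²))/(mρ)`, regular at `ρ = 0`). -/
def gV (m : ℚ) (ρ : ℝ) : ℝ := ρ / (1 + √(1 - m * ρ ^ 2))

/-- `1 + √(1 − mρ²) > 0`. -/
theorem one_add_sqrt_pos (m : ℚ) (ρ : ℝ) : 0 < 1 + √(1 - (m : ℝ) * ρ ^ 2) := by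
  positivity

/-- `U_m(V_m(ρ)) = ρ` for `m ρ² ≤ 1`. -/
theorem gU_gV {ρ : ℝ} (hρ : (m : ℝ) * ρ ^ 2 ≤ 1) : gU m (gV m ρ) = ρ := by
  unfold gU gV
  set s := √(1 - (m : ℝ) * ρ ^ 2) with hs
  have hs0 : 0 ≤ s := Real.sqrt_nonneg _
  have hs2 : s ^ 2 = 1 - m * ρ ^ 2 := Real.sq_sqrt (by linarith)
  have h1 : 1 + s ≠ 0 := by positivity
  have hden : 1 + (m : ℝ) * (ρ / (1 + s)) ^ 2 = 2 / (1 + s) := by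
    field_simp
    linear_combination hs2
  rw [hden]
  field_simp

/-- `m·V_m(ρ)² ≤ m ρ²` (so `V_m` maps `m ρ² < 1` into the chart domain `m v² < 1`). -/
theorem m_gV_sq_le (hm : 0 ≤ m) (ρ : ℝ) : (m : ℝ) * gV m ρ ^ 2 ≤ m * ρ ^ 2 := by
  have hm' : (0 : ℝ) ≤ m := by exact_mod_cast hm
  have hs0 : 0 ≤ √(1 - (m : ℝ) * ρ ^ 2) := Real.sqrt_nonneg _
  have h1 := one_add_sqrt_pos m ρ
  unfold gV
  rw [div_pow, ← mul_div_assoc]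
  refine (div_le_iff₀ (by positivity)).2 ?_
  have : (1 : ℝ) ≤ (1 + √(1 - (m : ℝ) * ρ ^ 2)) ^ 2 := by nlinarith
  nlinarith [mul_nonneg hm' (sq_nonneg ρ)]

/-- `V_m` is differentiable where `m ρ² < 1`. [calculus] -/
theorem differentiableAt_gV {ρ : ℝ} (hρ : (m : ℝ) * ρ ^ 2 < 1) : DifferentiableAt ℝ (gV m) ρ := by
  have h1 : DifferentiableAt ℝ (fun ρ : ℝ => 1 - (m : ℝ) * ρ ^ 2) ρ := by fun_prop
  have h2 : DifferentiableAt ℝ (fun ρ : ℝ => 1 + √(1 - (m : ℝ) * ρ ^ 2)) ρ :=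
    (h1.sqrt (by linarith)).const_add 1
  exact differentiableAt_id.div h2 (one_add_sqrt_pos m ρ).ne'

/-- `V_m` is injective on `m ρ² ≤ 1` (it has the left inverse `U_m`). -/
theorem gV_inj {ρ₁ ρ₂ : ℝ} (h₁ : (m : ℝ) * ρ₁ ^ 2 ≤ 1) (h₂ : (m : ℝ) * ρ₂ ^ 2 ≤ 1)
    (h : gV m ρ₁ = gV m ρ₂) : ρ₁ = ρ₂ := by
  rw [← gU_gV h₁, ← gU_gV h₂, h]

/-- `g_m(V_m(r(x)))·(V_m ∘ r)′(x) = T_m(V_m(r(x)))·r′(x)`: the chain rule through `U_m ∘ V_m = id`. -/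
theorem gW_gV_mul_deriv (hm : 0 ≤ m) {r : ℝ → ℝ} {r' x : ℝ} (hr : HasDerivAt r r' x)
    (hx : (m : ℝ) * r x ^ 2 < 1) :
    gW m (gV m (r x)) * deriv (fun s => gV m (r s)) x = gT m (gV m (r x)) * r' := by
  have hd : HasDerivAt (fun s => gV m (r s)) (deriv (fun s => gV m (r s)) x) x :=
    ((differentiableAt_gV hx).comp x hr.differentiableAt).hasDerivAt
  refine edge_weight hm (vb := fun s => gV m (r s)) (x := x) hd hr ?_
  have hc : ContinuousAt (fun s => (m : ℝ) * r s ^ 2) x := by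
    have := hr.continuousAt
    fun_prop
  have hev : ∀ᶠ s in nhds x, (m : ℝ) * r s ^ 2 < 1 := hc.eventually (Iio_mem_nhds hx)
  exact hev.mono fun s hs => gU_gV hs.le

end Summit.KontsevichZagierPeriods.RootDecompWalshStrata.ConicDescent.VertexChart
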